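import Literature.NumberTheory.EllipticCurves.LambdaAdicSelmerDataToCoeffTwistH1
import HarnessLib

/-!
# Iterated reductions `E[p^{k+d}] → E[p^k]` (`P ↦ p^d P`) on the compact Selmer levels and the REINDEXED hook of the
# Kolyvagin-system pushforward: `H¹(φ ⊗ p^d ·) ∘ comp_{A, k+d} = comp_{A′, k}` for the `Λ`-adic source level maps of
# `𝔖_p(K_∞)` (definitions with bodies + theorems)

Topic `NumberTheory/EllipticCurves` (sequel of `LambdaAdicSelmerDataToCoeffTwistH1`). Cell `pub/bsd-print-x9`, seat
`bsd-line-x9-p2` (g3): STUB 2 of the shared μ-item (crux stmt-BirchSwinnertonDyer-22642 / 27077). The source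
`CoeffTowerSetting` over `Λ` is REINDEXED before mapping to D1's Eisenstein target (x9-p1 LEAD g3 16:08:30Z (q2)(a): the
`Hom` level map `f k : N (σ k) → N′ k` exists only for `σ k ≫_{m,k} 0`; lit g31 16:15:31Z: «reduce coefficients
Λ/(ω_{σk}, p^{σk}) ↠ Λ/(q_m, p^{k+1}) AND E[p^{σk}] ↠ E[p^{k+1}]»). The E-part of such `f k` is an ITERATE of `P ↦ p P`;
this file supplies the iterate as a continuous intertwining map and the corresponding identity for the level maps of `𝔖`
(`LambdaAdicSelmerData.coeffComponent`): `H¹(coeffTwistReduce φ (p^d ·)) ∘ comp_{A,k+d} = comp_{A′,k}`, whose instance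
`A′ = A_{m,k}` is `eisensteinComponent D hm k` — i.e. «`one′ k = H¹(f k)(one (σ k))` IS D1's control map on `z`» along the
reindexed source.

* `torsionReduceIter t k d : E[p^{k+d}] →ⁱL E[p^k]` (composition of the one-step lifts `t`), `_zero`, `_succ`;
* `cohomologyMap_torsionReduceIter_proj` : on the `(n, ·)`-components of `s ∈ 𝔖_p(K_∞)`, `H¹(Γ_n, p^d ·) (proj n s)_{k+d} = (proj n s)_k`;
* **`map_coeffTwistReduce_coeffComponent_reduceIter`** : `H¹(φ ⊗ torsionReduceIter) (comp_{A,k+d,n} s) = comp_{A′,k,n} s`;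
* **`map_coeffTwistReduce_coeffComponent_reduceIter_eq_eisensteinComponent`** (`A′ = A_{m,k}`).
DEFINITIONS WITH BODIES + theorems; no named fact, no instance, no notation, no `sorry`. BSD is not proved by any of this.

References: [Howard2004HeegnerKolyvagin] B. Howard, Compositio Math. 140 (2004), Rem. 1.2.4 and proof of Thm. 2.2.10
(arXiv Thm. 3.2.10, p0017 L78–81), §2.2 Def. 2.2.3; [PerrinRiou1987BSMF] §0 p. 401; [SerreGaloisCohomology1997] I §2.2.
-/

noncomputable section

open scoped Topology Classical ContRepresentation
open Field CategoryTheory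

namespace WeierstrassCurve.LambdaAdicSelmerData

open Literature.NumberTheory.EllipticCurves Literature.NumberTheory.GaloisRepresentations

universe u

variable {K : Type u} [Field K] [NumberField K] {V : WeierstrassCurve K} [V.IsElliptic] {p : ℕ} [hp : Fact p.Prime]
  {κ : ZpExtension K p} {γ : absoluteGaloisGroup K} (D : V.LambdaAdicSelmerData κ γ)
  (t : ∀ k, (V.torsionGaloisModule ((p : ℤ) ^ (k + 1))).toContRepresentation →ⁱL
    (V.torsionGaloisModule ((p : ℤ) ^ k)).toContRepresentation)
  (ht : ∀ k (P : geomTorsion V ((p : ℤ) ^ (k + 1))), t k P = V.geomTorsionReduce p k P)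

/-! ## §1 The iterated reduction `E[p^{k+d}] → E[p^k]` -/

omit [NumberField K] [V.IsElliptic] in
/-- **The iterated reduction `E[p^{k+d}] → E[p^k]`** (`P ↦ p^d P`), as a continuous intertwining map: the `d`-fold composite
of the one-step lifts `t`. [cite: PerrinRiou1987BSMF, §0 p. 401 (transition maps = multiplication by p)] -/
def torsionReduceIter (k : ℕ) : ∀ d : ℕ,
    (V.torsionGaloisModule ((p : ℤ) ^ (k + d))).toContRepresentation →ⁱL
      (V.torsionGaloisModule ((p : ℤ) ^ k)).toContRepresentation
  | 0 => ContIntertwiningMap.id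
  | d + 1 => (torsionReduceIter k d).comp (t (k + d))

omit [NumberField K] [V.IsElliptic] hp in
/-- `torsionReduceIter t k 0 = id`. [cite: PerrinRiou1987BSMF, §0 p. 401] -/
theorem torsionReduceIter_zero_apply (k : ℕ) (P : geomTorsion V ((p : ℤ) ^ (k + 0))) :
    torsionReduceIter t k 0 P = P :=
  rfl

omit [NumberField K] [V.IsElliptic] hp in
/-- `torsionReduceIter t k (d+1) = torsionReduceIter t k d ∘ t (k+d)`. [cite: PerrinRiou1987BSMF, §0 p. 401] -/
theorem torsionReduceIter_succ_apply (k d : ℕ) (P : geomTorsion V ((p : ℤ) ^ (k + d + 1))) :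
    torsionReduceIter t k (d + 1) P = torsionReduceIter t k d (t (k + d) P) :=
  rfl

omit [NumberField K] [V.IsElliptic] hp in
/-- `H¹` of a composite of intertwining maps on a subgroup is the composite of the `H¹`'s (cocycle level).
[cite: SerreGaloisCohomology1997, I §2.2] -/
theorem cohomologyMap_subgroupRepHom_comp {k₁ k₂ k₃ : ℕ}
    (f : (V.torsionGaloisModule ((p : ℤ) ^ k₂)).toContRepresentation →ⁱL
      (V.torsionGaloisModule ((p : ℤ) ^ k₃)).toContRepresentation)
    (g : (V.torsionGaloisModule ((p : ℤ) ^ k₁)).toContRepresentation →ⁱL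
      (V.torsionGaloisModule ((p : ℤ) ^ k₂)).toContRepresentation)
    (N : Subgroup (absoluteGaloisGroup K)) (y : V.torsionH1Over ((p : ℤ) ^ k₁) N) :
    cohomologyMap (subgroupRepHom (TopRep.ofHom ⟨(f.comp g).toContinuousLinearMap, (f.comp g).isIntertwining'⟩) N) 1 y =
      cohomologyMap (subgroupRepHom (TopRep.ofHom ⟨f.toContinuousLinearMap, f.isIntertwining'⟩) N) 1
        (cohomologyMap (subgroupRepHom (TopRep.ofHom ⟨g.toContinuousLinearMap, g.isIntertwining'⟩) N) 1 y) := by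
  obtain ⟨ψ, rfl⟩ := oneCocycleClass_surjective (subgroupRep (V.torsionGaloisModule ((p : ℤ) ^ k₁)).toTopRep N) y
  rw [cohomologyMap_oneCocycleClass, cohomologyMap_oneCocycleClass, cohomologyMap_oneCocycleClass]
  refine congrArg _ (Subtype.ext (ContinuousMap.ext fun x ↦ ?_))
  rw [pullback_id_resIdHom_apply, pullback_id_resIdHom_apply, pullback_id_resIdHom_apply, subgroupRepHom_hom_apply,
    subgroupRepHom_hom_apply, subgroupRepHom_hom_apply]
  rfl

include ht in
omit [V.IsElliptic] in
/-- **`H¹(Γ_n, p^d ·) (proj n s)_{k+d} = (proj n s)_k`** for `s ∈ 𝔖_p(K_∞)`: the `d`-fold iterate of the `p_*`-compatibility of the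
compact Selmer families (`mem_compactSelmerOver_iff`, `cohomologyMap_subgroupRepHom_eq_reduceTorsionH1`).
[cite: PerrinRiou1987BSMF, §0 p. 401 (S_p(L) = lim← S(L)^{(p^k)} along multiplication by p)] -/
theorem cohomologyMap_torsionReduceIter_proj (n k d : ℕ) (s : D.S) :
    cohomologyMap (subgroupRepHom (TopRep.ofHom ⟨(torsionReduceIter t k d).toContinuousLinearMap,
      (torsionReduceIter t k d).isIntertwining'⟩) (κ.layerSubgroup n)) 1 (D.proj n s (k + d)) = D.proj n s k := by
  induction d with
  | zero => exact cohomologyMap_subgroupRepHom_eq_self_of_forall_eq k (torsionReduceIter t k 0) (fun _ ↦ rfl) _ _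
  | succ d ih =>
    have hcomp := cohomologyMap_subgroupRepHom_comp (torsionReduceIter t k d) (t (k + d)) (κ.layerSubgroup n)
      (D.proj n s (k + d + 1))
    change cohomologyMap (subgroupRepHom (TopRep.ofHom ⟨((torsionReduceIter t k d).comp (t (k + d))).toContinuousLinearMap,
      ((torsionReduceIter t k d).comp (t (k + d))).isIntertwining'⟩) (κ.layerSubgroup n)) 1 (D.proj n s (k + d + 1)) = _
    rw [hcomp, cohomologyMap_subgroupRepHom_eq_reduceTorsionH1 t ht (k + d),
      ((V.mem_compactSelmerOver_iff (κ.layerSubgroup n) p (D.proj n s)).1 (D.proj_mem n s)).2 (k + d), ih]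

/-! ## §2 The reindexed hook -/

section Hook

variable {A : Type} [CommRing A] {u : A} {J : ℕ} (hu : u ^ (p ^ J) = 1)
  {A' : Type} [CommRing A'] {u' : A'} {J' : ℕ} (hu' : u' ^ (p ^ J') = 1) (φ : A →+* A') (hφ : φ u = u')

include ht in
omit [V.IsElliptic] in
/-- **`H¹(φ ⊗ p^d ·) ∘ comp_{A, k+d} = comp_{A′, k}`** at every layer `n` above `J` and `J′`: the change of coefficients
`φ : A → A′` TOGETHER WITH the iterated module reduction `E[p^{k+d}] → E[p^k]` (the shape of the level maps of a `Hom` out of a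
REINDEXED `Λ`-adic source). [cite: Howard2004HeegnerKolyvagin, Rem. 1.2.4 and proof of Thm. 2.2.10 (arXiv Thm. 3.2.10, p0017 L78–81)]
[cite: PerrinRiou1987BSMF, §0 p. 401] -/
theorem map_coeffTwistReduce_coeffComponent_reduceIter (k d n : ℕ) (hn : J ≤ n) (hn' : J' ≤ n) (s : D.S) :
    galoisCohomology.map ((κ.unitTwist (-1)).coeffTwistReduce hu hu' φ hφ (torsionReduceIter t k d)) 1
        (D.coeffComponent hu (k + d) n hn s) = D.coeffComponent hu' k n hn' s := by
  haveI := κ.fintypeQuotientLayer n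
  rw [coeffComponent_apply, coeffComponent_apply,
    (κ.unitTwist (-1)).map_coeffTwistReduce_coresCoeff hu hu' φ hφ (torsionReduceIter t k d) (κ.layerSubgroup n)
      (layerSubgroup_le_unitTwist_layerSubgroup_of_le hn) (layerSubgroup_le_unitTwist_layerSubgroup_of_le hn')
      (κ.isOpen_layerSubgroup n),
    D.cohomologyMap_torsionReduceIter_proj t ht n k d s]

include ht in
omit [V.IsElliptic] in
/-- **The reindexed source-to-target level map IS D1's control component**: for `φ : A → A_{m,k}` with `φ u = 1 + T`,
`H¹(φ ⊗ p^d ·) (comp_{A, k+d, n} s) = eisensteinComponent D hm k n s` — with `A = Λ/(ω_{σ}, p^{k+d})` the Shapiro level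
`σ = k + d`, this is «`one′ k = H¹(f k)(one (σ k))` is D1's control map on `z`» for the REINDEXED pushforward.
[cite: Howard2004HeegnerKolyvagin, proof of Thm. 2.2.10 (arXiv Thm. 3.2.10, p0017 L78–81) and Rem. 1.2.4] -/
theorem map_coeffTwistReduce_coeffComponent_reduceIter_eq_eisensteinComponent {m : ℕ} (hm : 1 ≤ m) (k d n : ℕ)
    (hn : J ≤ n) (hn' : ZpExtension.eisensteinLevel (p := p) hm k ≤ n) (φ : A →+* IwasawaAlgebra.EisensteinCoeff p m k)
    (hφ : φ u = IwasawaAlgebra.EisensteinCoeff.onePlusT p m k) (s : D.S) :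
    galoisCohomology.map ((κ.unitTwist (-1)).coeffTwistReduce hu
        (ZpExtension.onePlusT_pow_prime_pow_eisensteinLevel (p := p) hm k) φ hφ (torsionReduceIter t k d)) 1
        (D.coeffComponent hu (k + d) n hn s) = D.eisensteinComponent hm k n hn' s :=
  D.map_coeffTwistReduce_coeffComponent_reduceIter t ht hu _ φ hφ k d n hn hn' s

end Hook

end WeierstrassCurve.LambdaAdicSelmerData

end
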